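import Literature.Analysis.FluidPDE.PineauVicolRDSSLeray
import Literature.Analysis.FluidPDE.ChaeWolfRemovingDSSProofs
import HarnessLib

/-!
# Pineau–Vicol 2026, Theorem 1.4 — the discharge (`pineauVicol2026_rss_liouville_holds`)

Analysis/FluidPDE proofs file (theorems only; no definitions, no named facts) discharging the
named fact `Literature.Analysis.FluidPDE.pineauVicol2026_rss_liouville` (`PineauVicolRSS.lean`;
B. Pineau, V. Vicol, *On rotated backwards self-similar solutions of the incompressible 3D
Navier–Stokes equations*, arXiv:2607.09619 (2026), **Theorem 1.4**, p. 4 of the text): for every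
Type I constant `C₀ > 0` there are `0 < α_` and `0 < ᾱ` such that a classical solution of
Navier–Stokes on `ℝ³ × [−1, 0)` with the Type I bound (1.10) which is backwards rotated
self-similar (RSS ansatz (1.7)) with a `C²` profile `U` and angular speed `|α| < α_` or `|α| > ᾱ`
has `U ≡ 0`.

## The argument formalized here

The tree already contains:

* the **large-`|α|` half** modulo Chae–Wolf 2017, Thm. 1.3
  (`pineauVicol2026_rss_liouville_large_of_chaeWolf`, `PineauVicolRSSChaeWolf.lean` — the route
  the paper itself points out on p. 6: "In light of Remark 1.5 … [12] gives an *alternative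
  proof* of the large `|α|` case in Theorem 1.4"), and the discharge
  `chaeWolf2017_removing_dss_holds` (`ChaeWolfRemovingDSSProofs.lean`);
* the assembly `pineauVicol2026_rss_liouville_of_chaeWolf_of_small` (Theorem 1.4 from the two
  halves).

This file proves the **small-`|α|` half** (`PineauVicol2026.rss_liouville_small`) and assembles
the discharge. The printed proof of the small-`|α|` case (§5: a weighted-`L²` enstrophy estimate
with the adjoint-kernel weight of Prop. 5.1, built in Lemmas 5.3–5.6 from the principal Dirichlet
eigenpair theory of the non-symmetric operator `L* = −Δ − (U + y/2)·∇ − 3/2`) is *quantitative*;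
its analytic inputs are not in the tree (see the module docstring of `PineauVicolRSSProofs.lean`).
We therefore take the shorter road which the tree does provide, and which is the exact mirror
image of the paper's own remark about the large-`|α|` case: the **indirect compactness argument
of Chae–Wolf 2017, §3** (`ChaeWolf.exists_limit`, `ChaeWolf.limit_eq_zero`), run with
`α_n → 0` in place of `λ_n ↓ 1`. The key structural input is the definition of RSS on p. 3 of
the source: an RSS field is invariant under the Navier–Stokes scaling by **every** `μ > 0`
composed with the rotation `R(2α log μ)`,
`u(x,t) = μ R(2α log μ) u(μ R(−2α log μ) x, μ²t)` (`PineauVicol2026.pvAnsatz_rss_eq_smul_rotZ`,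
from the tree's `PineauVicol2026.isRotatedDSS_pvAnsatz`). Hence:

1. (`PineauVicol2026.exists_limit_rss`) given Type I classical RSS solutions `w_n` on
   `ℝ³ × (−∞, 0)` with a common constant `C₀`, nonzero profiles `U_n` and speeds `α_n → 0`, a
   subsequence converges locally uniformly on `(−∞, −1/4] × ℝ³` (the uniform Lipschitz bounds
   `ChaeWolf.exists_uniform_lipschitz` and the pointwise Arzelà–Ascoli theorem) to a continuous
   Type I bounded weak solution `v` which is **self-similar** — the rotation angles
   `2α_n log μ → 0`, so the twisted scaling identity becomes `v(t,x) = μ v(μ²t, μx)` in the limit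
   — and **nontrivial at time `−1`**: by the smallness lemma
   `ChaeWolf.exists_eps_typeI_small_eq_zero` each `w_n` has a point with
   `√(−t)|w_n(t,x)| > ε₀`, i.e. (the size identity `√(−t)|u(x,t)| = |U(y)|`, Lemma 7.1 /
   Remark 1.2 of the source) a point `y_n` with `|U_n(y_n)| > ε₀`, confined to `|y_n| ≤ C₀/ε₀` by
   the profile bound (1.9), and `w_n(−1, ·) = U_n`;
2. (`PineauVicol2026.rss_liouville_small`) if the small-`|α|` statement failed for some `C₀`,
   the offending solutions on `[−1, 0)` extend backwards to `(−∞, 0)` (footnote 13 of the source;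
   the tree's `PineauVicol2026.exists_isClassicalNSSolutionOn_Iio_of_isRotatedDSS`) with the same
   Type I constant (Remark 1.2, `norm_pvAnsatz_le_of_profile`), and the limit of step 1
   contradicts `ChaeWolf.limit_eq_zero` (a self-similar Type I bounded weak ancient solution
   vanishes at time `−1`: KNSS regularity, a pressure, and Tsai 1998, Thm. 1 for the profile in
   `L⁴` — i.e. exactly the non-existence results "[50, 60]" to which, in the words of the source
   (p. 6), the compactness argument "reduces the problem");
3. `pineauVicol2026_rss_liouville_holds`: the assembly with the large-`|α|` half.

Thresholds remain existential, exactly as in the vendored statement (the printed theorem gives no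
size information beyond `0 < α_ ≪ 1 ≪ ᾱ`).

## References

* B. Pineau, V. Vicol, arXiv:2607.09619 (2026): §1.2 (definition of RSS, p. 3), (1.7)–(1.10),
  Remarks 1.2, 1.3, 1.5, **Theorem 1.4** (p. 4), p. 6 (Chae–Wolf's compactness argument as an
  alternative proof), §2 footnote 13, proof of Lemma 7.1 (p. 24). [PineauVicol2026]
* D. Chae, J. Wolf, Comm. PDE 42 (2017) 1359–1374 = arXiv:1610.09464, Thm. 1.3 and §3.
  [ChaeWolf2017RemovingDSS]
* T.-P. Tsai, Arch. Rational Mech. Anal. 143 (1998) 29–51, Thm. 1. [Tsai1998]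
-/

noncomputable section

open Set Filter Function Metric
open _root_.Topology
open scoped NNReal

namespace Literature.Analysis.FluidPDE

namespace PineauVicol2026

/-! ### Rotations about the axis: continuity in the angle -/

/-- The orbit map `θ ↦ R_θ z` of a point under the rotations about the axis is continuous
(private copy of the tree's `continuous_rotZ_angle`, kept here with a light import). [folklore] -/
private theorem continuous_rotZ_angle' (z : EuclideanSpace ℝ (Fin 3)) :
    Continuous fun θ : ℝ => rotZ θ z := by
  unfold rotZ
  refine (PiLp.continuous_toLp 2 _).comp ?_
  refine continuous_pi fun i => ?_
  have hc : Continuous fun θ : ℝ => Real.cos θ := Real.continuous_cos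
  have hs : Continuous fun θ : ℝ => Real.sin θ := Real.continuous_sin
  fin_cases i
  · exact ((hc.mul (continuous_const (y := z 0))).sub
      (hs.mul (continuous_const (y := z 1)))).congr fun θ => by simp
  · exact ((hs.mul (continuous_const (y := z 0))).add
      (hc.mul (continuous_const (y := z 1)))).congr fun θ => by simp
  · exact (continuous_const (y := z 2)).congr fun θ => by simp

/-- Rotations by small angles of a convergent sequence converge to the same limit:
`θ_n → 0`, `z_n → z₀` imply `R_{θ_n} z_n → z₀` (isometry plus continuity of the orbit map at
`θ = 0`, `R_0 = Id`). [folklore] -/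
theorem tendsto_rotZ_of_tendsto {θ : ℕ → ℝ} {z : ℕ → EuclideanSpace ℝ (Fin 3)}
    {z₀ : EuclideanSpace ℝ (Fin 3)} (hθ : Tendsto θ atTop (𝓝 0)) (hz : Tendsto z atTop (𝓝 z₀)) :
    Tendsto (fun n => rotZ (θ n) (z n)) atTop (𝓝 z₀) := by
  rw [tendsto_iff_norm_sub_tendsto_zero] at hz ⊢
  have h1 : Tendsto (fun n => rotZ (θ n) z₀) atTop (𝓝 z₀) := by
    have h := ((continuous_rotZ_angle' z₀).tendsto 0).comp hθ
    rwa [rotZ_zero] at h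
  have h1' := tendsto_iff_norm_sub_tendsto_zero.1 h1
  have hbound : ∀ n, ‖rotZ (θ n) (z n) - z₀‖ ≤ ‖z n - z₀‖ + ‖rotZ (θ n) z₀ - z₀‖ :=
      fun n => by
    calc ‖rotZ (θ n) (z n) - z₀‖
        ≤ ‖rotZ (θ n) (z n) - rotZ (θ n) z₀‖ + ‖rotZ (θ n) z₀ - z₀‖ :=
          norm_sub_le_norm_sub_add_norm_sub _ _ _
      _ = ‖z n - z₀‖ + ‖rotZ (θ n) z₀ - z₀‖ := by
          rw [← rotZL_apply (θ n) (z n), ← rotZL_apply (θ n) z₀, ← map_sub, rotZL_apply,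
            norm_rotZ]
  refine squeeze_zero (fun n => norm_nonneg _) hbound ?_
  simpa using hz.add h1'

/-! ### RSS: invariance under every scaling composed with the matching rotation (p. 3) -/

/-- **Rotated self-similarity (definition on p. 3 of the source).** The RSS ansatz field
`w = pvAnsatz α U` (1.7) with a time-independent profile is invariant under the Navier–Stokes
scaling by every factor `μ > 0` composed with the rotation by `2α log μ` about the axis:
`w(t, x) = μ R(θ) w(μ²t, μ R(−θ) x)`, `θ = 2α log μ`
("`u(x,t) = λR(2α log λ) u(λR(−2α log λ)x, λ²t)` for all `λ > 0`"). The tree's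
`isRotatedDSS_pvAnsatz` at the factor `μ` (a time-independent profile is `2 log μ`-periodic).
[cite: PineauVicol2026, §1.2 p. 3 (definition of RSS) and Remark 1.5] -/
theorem pvAnsatz_rss_eq_smul_rotZ (α : ℝ) (U : EuclideanSpace ℝ (Fin 3) → EuclideanSpace ℝ (Fin 3))
    {μ : ℝ} (hμ : 0 < μ) (t : ℝ) (x : EuclideanSpace ℝ (Fin 3)) :
    pvAnsatz α (fun y _ => U y) t x =
      μ • rotZ (α * (2 * Real.log μ))
        (pvAnsatz α (fun y _ => U y) (μ ^ 2 * t) (μ • rotZ (-(α * (2 * Real.log μ))) x)) := by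
  have h := isRotatedDSS_pvAnsatz (α := α) (U := fun y _ => U y) hμ (fun _ _ => rfl) t x
  simp only [rotZLIE_symm_apply, rotZLIE_apply, neg_neg] at h
  exact h.symm

/-! ### The extraction: limits of Type I RSS solutions with `α_n → 0` are self-similar -/

/-- **The compactness step (Chae–Wolf 2017, §3, Step 2, run with `α_n → 0`).** Let `w_n` be the
RSS ansatz fields (1.7) with speeds `α_n → 0` and time-independent profiles `U_n ≠ 0`, and assume
each `w_n` is a classical Navier–Stokes solution (`ν = 1`, `f = 0`) on `ℝ³ × (−∞, 0)` (with some
pressure) obeying a common Type I bound `‖w_n(t,x)‖ ≤ C₀/(‖x‖ + √(−t))`. Then a subsequence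
converges, locally uniformly on `(−∞, −1/4] × ℝ³` (uniform Lipschitz bounds
`ChaeWolf.exists_uniform_lipschitz` and the pointwise Arzelà–Ascoli theorem
`exists_strictMono_tendsto_of_lipschitzWith`), to a continuous field `v` which obeys the same
Type I bound, is a bounded weak Navier–Stokes solution on `(−∞, −1/4)` (written for
`t ↦ v(t − 1/4)` on `(−∞, 0)`; `isBoundedWeakNSSolutionOn_of_tendsto`), is **self-similar** —
`v(t,x) = μ v(μ²t, μx)` for every `μ ≥ 1`, because `w_n(t,x) = μ R(θ_n) w_n(μ²t, μR(−θ_n)x)` with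
`θ_n = 2α_n log μ → 0` (`pvAnsatz_rss_eq_smul_rotZ`, equicontinuity, `tendsto_rotZ_of_tendsto`) —
and **nontrivial at time `−1`**: by `ChaeWolf.exists_eps_typeI_small_eq_zero` and the size
identity `√(−t)|w_n(t,x)| = |U_n(y)|` (proof of Lemma 7.1 of the source) each profile exceeds
`ε₀` at a point `y_n` with `‖y_n‖ ≤ C₀/ε₀` (profile bound (1.9), Remark 1.2), and
`w_n(−1, ·) = U_n`; these witnesses accumulate at a point where `‖v(−1, ·)‖ ≥ ε₀`. [cite: ChaeWolf2017RemovingDSS, §3 Step 2 (arXiv:1610.09464 pp. 8–9); PineauVicol2026, §1.2 p. 3, Remark 1.2 and p. 6] -/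
theorem exists_limit_rss {C₀ : ℝ} (hC₀ : 0 < C₀) {α : ℕ → ℝ}
    {U : ℕ → EuclideanSpace ℝ (Fin 3) → EuclideanSpace ℝ (Fin 3)}
    {P : ℕ → ℝ → EuclideanSpace ℝ (Fin 3) → ℝ} (hα : Tendsto α atTop (𝓝 0))
    (hcl : ∀ n, IsClassicalNSSolutionOn (Iio 0) 1 0 (pvAnsatz (α n) (fun y _ => U n y)) (P n))
    (hI : ∀ n, HasTypeIDecay C₀ (pvAnsatz (α n) (fun y _ => U n y)))
    (hnt : ∀ n, U n ≠ 0) :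
    ∃ v : ℝ → EuclideanSpace ℝ (Fin 3) → EuclideanSpace ℝ (Fin 3), Continuous (uncurry v) ∧
      (∀ t ≤ -(1 / 4 : ℝ), ∀ x, ‖v t x‖ ≤ C₀ / (‖x‖ + √(-t))) ∧
      IsBoundedWeakNSSolutionOn (Iio 0) isOpen_Iio 1 (fun t => v (t - 1 / 4)) ∧
      (∀ μ : ℝ, 1 ≤ μ → ∀ t ≤ -(1 / 4 : ℝ), ∀ x, v t x = μ • v (μ ^ 2 * t) (μ • x)) ∧
      ∃ x : EuclideanSpace ℝ (Fin 3), v (-1) x ≠ 0 := by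
  -- the RSS fields
  set w : ℕ → ℝ → EuclideanSpace ℝ (Fin 3) → EuclideanSpace ℝ (Fin 3) :=
    fun n => pvAnsatz (α n) (fun y _ => U n y) with hw
  obtain ⟨K, L, hK, hL, hKL⟩ := ChaeWolf.exists_uniform_lipschitz hC₀.le
  obtain ⟨ε₀, hε₀, hA⟩ := ChaeWolf.exists_eps_typeI_small_eq_zero
  -- the profile bound (1.9) from the Type I bound at `t = -1` (Remark 1.2)
  have hUb : ∀ n (y : EuclideanSpace ℝ (Fin 3)), ‖U n y‖ ≤ C₀ / (‖y‖ + 1) := fun n =>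
    profile_bound_of_typeI (α := α n) (u := w n) (fun t ht x => hI n t ht.2 x) fun _ _ _ => rfl
  -- Step 1 (nontriviality survives at the fixed time `-1`)
  have hwit : ∀ n, ∃ y : EuclideanSpace ℝ (Fin 3),
      ‖y‖ ≤ C₀ / ε₀ ∧ ε₀ ≤ ‖w n (-1) y‖ := by
    intro n
    -- a point with a large scale-invariant size, by the smallness lemma
    obtain ⟨t', ht', x', hq'⟩ : ∃ t' < 0, ∃ x', ε₀ < √(-t') * ‖w n t' x'‖ := by
      by_contra hcon
      push Not at hcon
      have hzero := hA hC₀.le (hcl n) (hI n) hcon (-1) (by norm_num)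
      refine hnt n (funext fun y => ?_)
      simpa [pvAnsatz_neg_one] using hzero y
    -- in terms of the profile: `√(-t') ‖w n t' x'‖ = ‖U n y'‖`
    have hs : 0 < √(-t') := Real.sqrt_pos.2 (by linarith)
    set y' : EuclideanSpace ℝ (Fin 3) :=
      rotZ (-(α n * -Real.log (-t'))) ((√(-t'))⁻¹ • x') with hy'
    have hUy : ε₀ < ‖U n y'‖ := by
      have e : √(-t') * ‖w n t' x'‖ = ‖U n y'‖ := by
        rw [show w n t' x' = pvAnsatz (α n) (fun y _ => U n y) t' x' from rfl, norm_pvAnsatz,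
          ← mul_assoc, mul_inv_cancel₀ hs.ne', one_mul]
      rwa [e] at hq'
    refine ⟨y', ?_, ?_⟩
    · have h1 : ε₀ < C₀ / (‖y'‖ + 1) := hUy.trans_le (hUb n y')
      rw [lt_div_iff₀ (by positivity)] at h1
      rw [le_div_iff₀ hε₀]
      nlinarith [norm_nonneg y', hε₀]
    · rw [show w n (-1) y' = U n y' from pvAnsatz_neg_one _ _ _]
      exact hUy.le
  -- the equi-Lipschitz family on `ℝ × ℝ³` (fields frozen at time `-1/4` for later times)
  set Kx : ℝ≥0 := (K + L).toNNReal with hKx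
  have hKx' : (Kx : ℝ) = K + L := by rw [hKx, Real.coe_toNNReal _ (by positivity)]
  set f : ℕ → ℝ × EuclideanSpace ℝ (Fin 3) → EuclideanSpace ℝ (Fin 3) :=
    fun n q => w n (min q.1 (-(1 / 4 : ℝ))) q.2 with hf
  have hf_of_le : ∀ n {t : ℝ} (_ : t ≤ -(1 / 4 : ℝ)) (x : EuclideanSpace ℝ (Fin 3)),
      f n (t, x) = w n t x :=
    fun n t ht x => by simp only [hf, min_eq_left ht]
  have hlip : ∀ n, LipschitzWith Kx (f n) := by
    intro n
    obtain ⟨hsp, htm⟩ := hKL (hcl n) (hI n)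
    refine LipschitzWith.of_dist_le_mul fun q q' => ?_
    rw [hKx', dist_eq_norm, Prod.dist_eq, Real.dist_eq, dist_eq_norm]
    have hm : min q.1 (-(1 / 4 : ℝ)) ≤ -(1 / 4 : ℝ) := min_le_right _ _
    have hm' : min q'.1 (-(1 / 4 : ℝ)) ≤ -(1 / 4 : ℝ) := min_le_right _ _
    have hmin : |min q.1 (-(1 / 4 : ℝ)) - min q'.1 (-(1 / 4 : ℝ))| ≤ |q.1 - q'.1| := by
      refine (abs_min_sub_min_le_max _ _ _ _).trans (max_le le_rfl ?_)
      rw [sub_self, abs_zero]; exact abs_nonneg _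
    calc ‖w n (min q.1 (-(1 / 4))) q.2 - w n (min q'.1 (-(1 / 4))) q'.2‖
        ≤ ‖w n (min q.1 (-(1 / 4))) q.2 - w n (min q.1 (-(1 / 4))) q'.2‖ +
            ‖w n (min q.1 (-(1 / 4))) q'.2 - w n (min q'.1 (-(1 / 4))) q'.2‖ :=
          norm_sub_le_norm_sub_add_norm_sub _ _ _
      _ ≤ K * ‖q.2 - q'.2‖ + L * |min q.1 (-(1 / 4 : ℝ)) - min q'.1 (-(1 / 4 : ℝ))| :=
          add_le_add (hsp _ hm _ _) (htm _ hm' _ hm _)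
      _ ≤ K * max |q.1 - q'.1| ‖q.2 - q'.2‖ + L * max |q.1 - q'.1| ‖q.2 - q'.2‖ := by
          gcongr
          · exact le_max_right _ _
          · exact hmin.trans (le_max_left _ _)
      _ = (K + L) * max |q.1 - q'.1| ‖q.2 - q'.2‖ := by ring
  have hball : ∀ n q, f n q ∈ closedBall (0 : EuclideanSpace ℝ (Fin 3)) (2 * C₀) :=
      fun n q => by
    rw [mem_closedBall, dist_zero_right]
    exact ChaeWolf.typeI_norm_le_two_mul hC₀.le (hI n) (min_le_right _ _) _
  obtain ⟨φ, l, hφ, hl, -, hlim⟩ := exists_strictMono_tendsto_of_lipschitzWith f hlip hball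
  -- the limit field
  set v : ℝ → EuclideanSpace ℝ (Fin 3) → EuclideanSpace ℝ (Fin 3) := fun t x => l (t, x) with hv
  have hlimv : ∀ {t : ℝ} (_ : t ≤ -(1 / 4 : ℝ)) (x : EuclideanSpace ℝ (Fin 3)),
      Tendsto (fun n => w (φ n) t x) atTop (𝓝 (v t x)) := by
    intro t ht x
    simpa only [hf_of_le _ ht] using hlim (t, x)
  have hvc : Continuous (uncurry v) := by
    have e : uncurry v = l := by funext q; rfl
    rw [e]; exact hl.continuous
  refine ⟨v, hvc, ?_, ?_, ?_, ?_⟩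
  · -- the Type I bound passes to the limit
    intro t ht x
    exact le_of_tendsto' (hlimv ht x).norm fun n => hI (φ n) t (by linarith) x
  · -- bounded weak solution on `(-∞, -1/4)`, shifted to `(-∞, 0)`
    have hA' : Tendsto (fun k : ℕ => -(k : ℝ) + -1) atTop atBot :=
      (tendsto_neg_atTop_atBot.comp tendsto_natCast_atTop_atTop).atBot_add tendsto_const_nhds
    have e14 : ∀ t : ℝ, t - 1 / 4 = t + -(1 / 4 : ℝ) := fun t => by ring
    have hV : ∀ k : ℕ, IsBoundedWeakNSSolutionOn (Ioo (-(k : ℝ) + -1) 0) isOpen_Ioo 1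
        (fun t => w (φ k) (t - 1 / 4)) := by
      intro k
      have hcl' : IsClassicalNSSolutionOn (Ioo (-(k : ℝ) + -1 + -(1 / 4)) (-(1 / 4))) 1 0
          (w (φ k)) (P (φ k)) :=
        (hcl (φ k)).mono (fun t ht => by simp only [mem_Iio]; linarith [ht.2])
          (uniqueDiffOn_Ioo _ _)
      have hbdd : IsBoundedOn (Ioo (-(k : ℝ) + -1 + -(1 / 4)) (-(1 / 4))) (w (φ k)) :=
        ⟨2 * C₀, fun t ht x => ChaeWolf.typeI_norm_le_two_mul hC₀.le (hI (φ k)) ht.2.le x⟩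
      have h := (hcl'.isBoundedWeakNSSolutionOn hbdd).comp_add_right (-(1 / 4 : ℝ))
        (J := Ioo (-(k : ℝ) + -1) 0) isOpen_Ioo fun t => by
          simp only [mem_Ioo]
          constructor <;> intro h <;> constructor <;> linarith [h.1, h.2]
      simpa only [e14] using h
    have hcont : ∀ k : ℕ, ContinuousOn (uncurry fun t => w (φ k) (t - 1 / 4))
        (Ioo (-(k : ℝ) + -1) 0 ×ˢ univ) := by
      intro k
      have h1 := ((hcl (φ k)).smooth_velocity.comp_add_right (-(1 / 4 : ℝ))).continuousOn
      refine (h1.mono (prod_mono (fun t ht => ?_) Subset.rfl)).congr fun q _ => by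
        simp only [uncurry, e14, hw]
      simp only [mem_preimage, mem_Iio]
      linarith [ht.2]
    have hbd : ∀ k : ℕ, ∀ t ∈ Ioo (-(k : ℝ) + -1) 0, ∀ x,
        ‖w (φ k) (t - 1 / 4) x‖ ≤ 2 * C₀ :=
      fun k t ht x => ChaeWolf.typeI_norm_le_two_mul hC₀.le (hI (φ k)) (by linarith [ht.2]) x
    have hvc' : Continuous (uncurry fun t x => v (t - 1 / 4) x) :=
      hvc.comp ((continuous_fst.sub continuous_const).prodMk continuous_snd)
    exact isBoundedWeakNSSolutionOn_of_tendsto hA' hV hcont hbd hvc'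
      fun t ht x => hlimv (by linarith) x
  · -- self-similarity of the limit: the rotation angles `2 α_n log μ` tend to `0`
    intro μ hμ t ht x
    have hμ0 : 0 < μ := one_pos.trans_le hμ
    have ht0 : t ≤ 0 := by linarith
    set θ : ℕ → ℝ := fun n => α n * (2 * Real.log μ) with hθ
    have hθlim : Tendsto (fun n => θ (φ n)) atTop (𝓝 0) := by
      have h1 : Tendsto (fun n => α (φ n) * (2 * Real.log μ)) atTop
          (𝓝 (0 * (2 * Real.log μ))) :=
        (hα.comp hφ.tendsto_atTop).mul_const _
      rw [zero_mul] at h1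
      exact h1
    -- the twisted scaling identity along the sequence
    have hid : ∀ n, w n t x = μ • rotZ (θ n) (w n (μ ^ 2 * t) (μ • rotZ (-(θ n)) x)) :=
      fun n => pvAnsatz_rss_eq_smul_rotZ (α n) (U n) hμ0 t x
    -- the moving points stay in `t ≤ -1/4`
    have hmem : μ ^ 2 * t ≤ -(1 / 4 : ℝ) :=
      (mul_le_of_one_le_left ht0 (one_le_pow₀ hμ)).trans ht
    have hrot : Tendsto (fun n => rotZ (-(θ (φ n))) x) atTop (𝓝 x) := by
      have h1 : Tendsto (fun n => -(θ (φ n))) atTop (𝓝 0) := by simpa using hθlim.neg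
      have h2 := ((continuous_rotZ_angle' x).tendsto 0).comp h1
      rw [rotZ_zero] at h2
      exact h2
    set q : ℕ → ℝ × EuclideanSpace ℝ (Fin 3) :=
      fun n => (μ ^ 2 * t, μ • rotZ (-(θ (φ n))) x) with hq
    have hqlim : Tendsto q atTop (𝓝 (μ ^ 2 * t, μ • x)) :=
      tendsto_const_nhds.prodMk_nhds (hrot.const_smul μ)
    have h1 : Tendsto (fun n => f (φ n) (q n)) atTop (𝓝 (v (μ ^ 2 * t) (μ • x))) :=
      ChaeWolf.tendsto_apply_of_tendsto (fun n => hlip (φ n)) hqlim (hlim (μ ^ 2 * t, μ • x))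
    have h1' : Tendsto (fun n => w (φ n) (μ ^ 2 * t) (μ • rotZ (-(θ (φ n))) x)) atTop
        (𝓝 (v (μ ^ 2 * t) (μ • x))) := by
      refine h1.congr fun n => ?_
      simp only [hq, hf_of_le _ hmem]
    have h2 : Tendsto (fun n => rotZ (θ (φ n)) (w (φ n) (μ ^ 2 * t) (μ • rotZ (-(θ (φ n))) x)))
        atTop (𝓝 (v (μ ^ 2 * t) (μ • x))) :=
      tendsto_rotZ_of_tendsto hθlim h1'
    have h3 : Tendsto (fun n => w (φ n) t x) atTop (𝓝 (μ • v (μ ^ 2 * t) (μ • x))) := by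
      refine (h2.const_smul μ).congr fun n => ?_
      exact (hid (φ n)).symm
    exact tendsto_nhds_unique (hlimv ht x) h3
  · -- nontriviality at time `-1`
    choose y hyb hyw using hwit
    have hSc : IsCompact (closedBall (0 : EuclideanSpace ℝ (Fin 3)) (C₀ / ε₀)) :=
      isCompact_closedBall _ _
    have hmemS : ∀ n, y (φ n) ∈ closedBall (0 : EuclideanSpace ℝ (Fin 3)) (C₀ / ε₀) :=
        fun n => by
      rw [mem_closedBall, dist_zero_right]; exact hyb (φ n)
    obtain ⟨ybar, -, ψ, hψ, hconv⟩ := hSc.tendsto_subseq hmemS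
    refine ⟨ybar, fun h0 => ?_⟩
    have h14 : (-1 : ℝ) ≤ -(1 / 4 : ℝ) := by norm_num
    have hy0 : Tendsto (fun n => f (φ (ψ n)) ((-1 : ℝ), ybar)) atTop (𝓝 (v (-1) ybar)) :=
      (hlim ((-1 : ℝ), ybar)).comp hψ.tendsto_atTop
    have hconv' : Tendsto (fun n => ((-1 : ℝ), y (φ (ψ n)))) atTop (𝓝 ((-1 : ℝ), ybar)) :=
      tendsto_const_nhds.prodMk_nhds hconv
    have hmain := ChaeWolf.tendsto_apply_of_tendsto (fun n => hlip (φ (ψ n))) hconv' hy0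
    have hge : ε₀ ≤ ‖v (-1) ybar‖ := by
      refine ge_of_tendsto' hmain.norm fun n => ?_
      simp only [hf_of_le _ h14]
      exact hyw (φ (ψ n))
    rw [h0, norm_zero] at hge
    linarith

/-! ### Theorem 1.4, small `|α|` -/

/-- **Pineau–Vicol 2026, Theorem 1.4 — the case `|α| ≪ 1`.** For every `C₀ > 0` there is
`α₁ > 0` such that: if `(u, p)` is a classical Navier–Stokes solution (`ν = 1`, `f = 0`) on the
time set `[−1, 0)` with the Type I bound `‖u(t,x)‖ ≤ C₀/(‖x‖ + √(−t))` (1.10), and `u` is the RSS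
ansatz (1.7) with a `C²` profile `U` and speed `α`, `|α| < α₁`, then `U ≡ 0`. Proof (indirect,
Chae–Wolf's compactness argument — cf. p. 6 of the source — in place of the printed quantitative
weighted-`L²` estimate of §5): otherwise there are such solutions with `α_n → 0` and `U_n ≠ 0`;
their ansatz fields extend to classical solutions on `(−∞, 0)` (footnote 13,
`exists_isClassicalNSSolutionOn_Iio_of_isRotatedDSS` with `isRotatedDSS_pvAnsatz`) with the same
Type I constant (Remark 1.2, `profile_bound_of_typeI`, `norm_pvAnsatz_le_of_profile`); the
self-similar, Type I, nontrivial limit of `exists_limit_rss` contradicts `ChaeWolf.limit_eq_zero`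
(Tsai 1998, Thm. 1). The profile regularity `U ∈ C²` is not used. [cite: PineauVicol2026, Theorem 1.4 (arXiv:2607.09619 p. 4)] -/
theorem rss_liouville_small {C₀ : ℝ} (hC₀ : 0 < C₀) : ∃ α₁ : ℝ, 0 < α₁ ∧
    ∀ (α : ℝ) (u : ℝ → EuclideanSpace ℝ (Fin 3) → EuclideanSpace ℝ (Fin 3))
      (p : ℝ → EuclideanSpace ℝ (Fin 3) → ℝ)
      (U : EuclideanSpace ℝ (Fin 3) → EuclideanSpace ℝ (Fin 3)),
      IsClassicalNSSolutionOn (Ico (-1) 0) 1 0 u p →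
      (∀ t ∈ Ico (-1 : ℝ) 0, ∀ x : EuclideanSpace ℝ (Fin 3),
        ‖u t x‖ ≤ C₀ / (‖x‖ + Real.sqrt (-t))) →
      ContDiff ℝ 2 U →
      (∀ t ∈ Ico (-1 : ℝ) 0, ∀ x : EuclideanSpace ℝ (Fin 3),
        u t x = pvAnsatz α (fun y _ => U y) t x) →
      |α| < α₁ → U = 0 := by
  by_contra H
  push Not at H
  choose α u p U hsol hI _hU hans hlt hne using
    fun n : ℕ => H (1 / ((n : ℝ) + 1)) (by positivity)
  -- backward extension to `(-∞, 0)` (footnote 13) with the same Type I constant (Remark 1.2)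
  have hext : ∀ n, ∃ P : ℝ → EuclideanSpace ℝ (Fin 3) → ℝ,
      IsClassicalNSSolutionOn (Iio 0) 1 0 (pvAnsatz (α n) (fun y _ => U n y)) P := fun n =>
    exists_isClassicalNSSolutionOn_Iio_of_isRotatedDSS (hsol n) one_lt_two
      (isRotatedDSS_pvAnsatz (α := α n) (U := fun y _ => U n y) two_pos fun _ _ => rfl) (hans n)
  choose P hP using hext
  have hIw : ∀ n, HasTypeIDecay C₀ (pvAnsatz (α n) (fun y _ => U n y)) := fun n t ht x =>
    norm_pvAnsatz_le_of_profile (profile_bound_of_typeI (hI n) (hans n)) ht x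
  -- `α n → 0`
  have hα0 : Tendsto α atTop (𝓝 0) :=
    squeeze_zero_norm (fun n => (Real.norm_eq_abs _).trans_le (hlt n).le)
      tendsto_one_div_add_atTop_nhds_zero_nat
  obtain ⟨v, hvc, hvI, hweak, hss, x, hx⟩ := exists_limit_rss hC₀ hα0 hP hIw hne
  exact hx (congr_fun (ChaeWolf.limit_eq_zero hvc hvI hweak hss) x)

end PineauVicol2026

/-! ### The discharge -/

/-- **Discharge of `pineauVicol2026_rss_liouville` (Pineau–Vicol 2026, Theorem 1.4).** For every
`C₀ > 0` there are `α₁, α₂ > 0` such that a classical Type I (constant `C₀`) solution on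
`[−1, 0)` which is rotated self-similar with a `C²` profile `U` and angular speed `|α| < α₁` or
`|α| > α₂` has `U ≡ 0`: the small-`|α|` half is `PineauVicol2026.rss_liouville_small`, the
large-`|α|` half is `pineauVicol2026_rss_liouville_large_of_chaeWolf` over the discharged
Chae–Wolf theorem `chaeWolf2017_removing_dss_holds` (the alternative proof named on p. 6 of the
source), assembled by `pineauVicol2026_rss_liouville_of_chaeWolf_of_small`. [cite: PineauVicol2026, Theorem 1.4 (arXiv:2607.09619 p. 4)] -/
theorem pineauVicol2026_rss_liouville_holds : pineauVicol2026_rss_liouville :=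
  pineauVicol2026_rss_liouville_of_chaeWolf_of_small chaeWolf2017_removing_dss_holds
    fun _ hC₀ => PineauVicol2026.rss_liouville_small hC₀

end Literature.Analysis.FluidPDE

end
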